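import Summits.NavierStokesRegularity.FluidComputer.CriticalLevels
import Summits.NavierStokesRegularity.FluidComputer.CriticalDatumFloor
import Summits.NavierStokesRegularity.NavierStokesRegularity.Theorems.FluidComputerCascade
import HarnessLib

/-!
# Fluid computer — the CRITICAL FACE of the level dictionary, assembled (L27–L29), and read on the interface

HONEST FRAMING (cell `pub-fluidc`, verbatim): *low prior, high value-of-information experiment on Tao's
machine paradigm; NOT a claim that NS blows up.* Theorem side of the cell; nothing here is evidence of blow-up.
One statement for the paper's §4, companion of `CascadeNecessities.cascade_necessities` (the flux face assembled)
and `LerayTimeFace.time_face` (the time face assembled): the SCALE-INVARIANT necessities of a realised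
finite-energy blow-up, with two absolute constants.

* `critical_face` — absolute `δ, δ'' > 0` such that for every `ν > 0`, `T > 0` and every maximal smooth solution
  `(u, p)` of the unforced Navier–Stokes system on `ℝ³ × [0, T)` which is Leray–Hopf from `u 0`:
  (D) if the datum is bounded, `δ ν < ‖u(0)‖_{L³}` (`CriticalDatumFloor.eLpNorm_three_floor'`, Kato 1984);
  (S) `‖u(t)‖_{L³} → ∞` as `t ↑ T` (`CriticalDivergence.eLpNorm_three_tendsto_top`, Seregin 2012);
  (A) for every level `J`, `∑_{n≥0} 2^{(J+n)/2} ‖Δ̇_{J+n} u(t)‖₂ → ∞` as `t ↑ T`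
  (`CriticalLevels.besovHalf_tail_tendsto_top`: in the critical currency the blow-up lives above every fixed level);
  and at EVERY instant `t ∈ (0, T)`: (K) `δ ν < ‖u(t)‖_{L³}`; (M) `δ ν < ∑_j (s_j(t) a_j(t)²)^{1/3}`
  (`CriticalLevels.eLpNorm_three_le_tsum_mixed`); (B) `δ'' ν < ∑_j 2^{j/2} a_j(t)`
  (`CriticalLevels.besovHalf_level_floor`) — `a_j = ‖Δ̇_j u‖₂`, `s_j = ‖Δ̇_j u‖_∞`.
* `critical_face_of_cascadeWitness` — the same read on the cell's interface: every `W : CascadeWitness` yields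
  (via `x5a_of_cascadeWitness'`) a maximal smooth Leray–Hopf solution with a rapidly decaying — hence bounded —
  datum, so (D) holds unconditionally: a cascade witness is never critically small, from its datum to its
  lifespan, and its critical size diverges. Companion of `CascadeWitnessFloor` / `CascadeWitnessClock`.

Reading (words, for the writer). The critical face carries NO rate and NO power of `T − t`: it is what the
Navier–Stokes scaling cannot rescale away. Against the machine paradigm it says three things — a candidate datum
must already exceed Kato's threshold (`‖u₀‖_{L³} > δν`: the first, data-level test); along the run the critical
size never dips below it; and at the lifespan the critical size diverges, above every fixed level, so a blow-up is
not a fixed profile collapsing self-similarly at constant `L³` size ('one eddy that shrinks') but an unbounded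
accumulation of critical size at ever finer levels. HONEST SIZE NOTE: `δ`, `δ''` inexplicit (Kato's fixed-point
constant; Bernstein); at the cell's `ρ = 3`, `δν ≈ 3.3·10⁻³ δ` — words, not numbers. Necessity only; nothing
about sufficiency. 0 sorry; no new definitions, no named facts.

## References

* G. Seregin, Comm. Math. Phys. 312 (2012) 833–845, Thm. 1.1. [Seregin2012]
* T. Kato, Math. Z. 187 (1984) 471–480, Thms. 2 and 4. [Kato1984MathZ]
* L. Escauriaza, G. Seregin, V. Šverák, Russ. Math. Surveys 58:2 (2003) 211–250. [EscauriazaSereginSverak2003]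
* H. Bahouri, J.-Y. Chemin, R. Danchin, *Fourier Analysis and Nonlinear PDE*, Springer 2011, Lemma 2.1,
  Prop. 2.12. [BahouriCheminDanchin2011]
-/

noncomputable section

open MeasureTheory Set Function Filter Topology Metric
open scoped ENNReal NNReal
open Literature.Analysis.FluidPDE Literature.Analysis.FunctionSpaces Literature.Analysis.FluidPDE.FluidComputer
open Summit.NavierStokesRegularity.NavierStokesRegularity.Theorems.FluidComputer (x5a_of_cascadeWitness')
open Summit.NavierStokesRegularity.FluidComputer.CriticalDivergence
open Summit.NavierStokesRegularity.FluidComputer.CriticalLevels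
open Summit.NavierStokesRegularity.FluidComputer.CriticalDatumFloor

namespace Summit.NavierStokesRegularity.FluidComputer.CriticalFace

/-- **THE CRITICAL FACE OF THE LEVEL DICTIONARY, ASSEMBLED (L27–L29).** There are absolute constants
`δ, δ'' > 0` such that for every `ν > 0`, `T > 0` and every maximal smooth solution `(u, p)` of the unforced
Navier–Stokes system on `ℝ³ × [0, T)` which is Leray–Hopf from `u 0`:
(D) `δ ν < ‖u(0)‖_{L³}` if the datum is bounded; (S) `‖u(t)‖_{L³} → ∞` as `t ↑ T`; (A) for every level `J ∈ ℤ`,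
`∑_{n≥0} 2^{(J+n)/2} ‖Δ̇_{J+n} u(t)‖₂ → ∞` as `t ↑ T`; and for every `t ∈ (0, T)`: (K) `δ ν < ‖u(t)‖_{L³}`,
(M) `δ ν < ∑_{j∈ℤ} (‖Δ̇_j u(t)‖_∞ ‖Δ̇_j u(t)‖₂²)^{1/3}`, (B) `δ'' ν < ∑_{j∈ℤ} 2^{j/2} ‖Δ̇_j u(t)‖₂`. Assembly of
`CriticalDatumFloor.eLpNorm_three_floor'`, `CriticalDivergence.eLpNorm_three_tendsto_top`,
`CriticalLevels.besovHalf_tail_tendsto_top`, `CriticalLevels.eLpNorm_three_le_tsum_mixed`,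
`CriticalLevels.besovHalf_level_floor`. Scale-invariant throughout; necessity only.
[cite: Seregin2012, Thm. 1.1] [cite: Kato1984MathZ, Thms. 2 and 4] [cite: BahouriCheminDanchin2011, Lemma 2.1 and Prop. 2.12] -/
theorem critical_face :
    ∃ δ δ'' : ℝ, 0 < δ ∧ 0 < δ'' ∧ ∀ (ν T : ℝ), 0 < ν → 0 < T →
      ∀ (u : ℝ → EuclideanSpace ℝ (Fin 3) → EuclideanSpace ℝ (Fin 3)) (p : ℝ → EuclideanSpace ℝ (Fin 3) → ℝ),
      IsMaximalSmoothSolution ν 0 u p T → IsLerayHopfOn T ν 0 (u 0) u →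
      ((∃ B₀ : ℝ, ∀ x, ‖u 0 x‖ ≤ B₀) → ENNReal.ofReal (δ * ν) < eLpNorm (u 0) 3 volume) ∧
      Tendsto (fun t => eLpNorm (u t) 3 volume) (𝓝[<] T) (𝓝 ∞) ∧
      (∀ J : ℤ, Tendsto (fun t => ∑' n : ℕ, (2 : ℝ≥0∞) ^ (((J + n : ℤ) : ℝ) / 2) * blockL2 (u t) (J + n))
        (𝓝[<] T) (𝓝 ∞)) ∧
      ∀ t ∈ Ioo 0 T,
        ENNReal.ofReal (δ * ν) < eLpNorm (u t) 3 volume ∧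
        ENNReal.ofReal (δ * ν) < ∑' j : ℤ, (blockSup (u t) j * blockL2 (u t) j ^ 2) ^ (1 / 3 : ℝ) ∧
        ENNReal.ofReal (δ'' * ν) < ∑' j : ℤ, (2 : ℝ≥0∞) ^ ((j : ℝ) / 2) * blockL2 (u t) j := by
  obtain ⟨δ, hδ, HK⟩ := eLpNorm_three_floor'
  obtain ⟨δ'', hδ'', HB⟩ := besovHalf_level_floor
  refine ⟨δ, δ'', hδ, hδ'', fun ν T hν hT u p hmax hLH => ?_⟩
  obtain ⟨hint, hdat⟩ := HK ν T hν hT u p hmax hLH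
  refine ⟨hdat, eLpNorm_three_tendsto_top hν hT hmax hLH,
    fun J => besovHalf_tail_tendsto_top hν hT hmax hLH J, fun t ht => ⟨hint t ht, ?_, HB ν T hν hT u p hmax hLH t ht⟩⟩
  exact (hint t ht).trans_le
    (eLpNorm_three_le_tsum_mixed (hLH.memLp t ⟨ht.1.le, ht.2.le⟩) (memLp_three_slice hν hT hmax.1 hLH ht))

/-- A rapidly decaying field is bounded (the case `n = K = 0` of `HasRapidSpatialDecay`). [folklore] -/
theorem exists_bound_of_hasRapidSpatialDecay {u₀ : EuclideanSpace ℝ (Fin 3) → EuclideanSpace ℝ (Fin 3)}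
    (h : HasRapidSpatialDecay u₀) : ∃ B₀ : ℝ, ∀ x, ‖u₀ x‖ ≤ B₀ := by
  obtain ⟨C, hC⟩ := h 0 0
  refine ⟨C, fun x => ?_⟩
  have hx := hC x
  simpa only [pow_zero, one_mul, norm_iteratedFDeriv_zero] using hx

/-- **THE CRITICAL FACE READ ON THE INTERFACE: every cascade witness is critically large, from its datum to its
lifespan.** With the constants `δ, δ''` of `critical_face`: every `W : CascadeWitness` yields `ν > 0`, `T > 0`
and a maximal smooth solution `(u, p)` of the unforced Navier–Stokes system on `ℝ³ × [0, T)`, Leray–Hopf from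
`u 0`, with (D) `δ ν < ‖u(0)‖_{L³}` (the witness's datum decays rapidly, hence is bounded), (S) `‖u(t)‖_{L³} → ∞`
as `t ↑ T`, and for every `t ∈ (0, T)`: (K) `δ ν < ‖u(t)‖_{L³}` and (B) `δ'' ν < ∑_j 2^{j/2} ‖Δ̇_j u(t)‖₂`
(`critical_face` composed with `x5a_of_cascadeWitness'`). Companion of `CascadeWitnessFloor.dyadic_floor_of_cascadeWitness`
and `CascadeWitnessClock.time_face_of_cascadeWitness`. [cite: Seregin2012, Thm. 1.1] [cite: Kato1984MathZ, Thms. 2 and 4] -/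
theorem critical_face_of_cascadeWitness :
    ∃ δ δ'' : ℝ, 0 < δ ∧ 0 < δ'' ∧ ∀ W : CascadeWitness, ∃ ν : ℝ, 0 < ν ∧ ∃ T : ℝ, 0 < T ∧
      ∃ (u : ℝ → EuclideanSpace ℝ (Fin 3) → EuclideanSpace ℝ (Fin 3))
        (p : ℝ → EuclideanSpace ℝ (Fin 3) → ℝ),
        IsMaximalSmoothSolution ν 0 u p T ∧ IsLerayHopfOn T ν 0 (u 0) u ∧
        ENNReal.ofReal (δ * ν) < eLpNorm (u 0) 3 volume ∧
        Tendsto (fun t => eLpNorm (u t) 3 volume) (𝓝[<] T) (𝓝 ∞) ∧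
        ∀ t ∈ Ioo 0 T, ENNReal.ofReal (δ * ν) < eLpNorm (u t) 3 volume ∧
          ENNReal.ofReal (δ'' * ν) < ∑' j : ℤ, (2 : ℝ≥0∞) ^ ((j : ℝ) / 2) * blockL2 (u t) j := by
  obtain ⟨δ, δ'', hδ, hδ'', H⟩ := critical_face
  refine ⟨δ, δ'', hδ, hδ'', fun W => ?_⟩
  obtain ⟨ν, hν, T, hT, u, p, hmax, hLH, hdec⟩ := x5a_of_cascadeWitness' W
  obtain ⟨hD, hS, -, hrest⟩ := H ν T hν hT u p hmax hLH
  refine ⟨ν, hν, T, hT, u, p, hmax, hLH, hD (exists_bound_of_hasRapidSpatialDecay hdec), hS, fun t ht => ?_⟩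
  obtain ⟨h1, -, h3⟩ := hrest t ht
  exact ⟨h1, h3⟩

end Summit.NavierStokesRegularity.FluidComputer.CriticalFace

end
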